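import Summits.Ventures.DiscreteObjects.Hadamard.GSRowSums167
import Literature.Combinatorics.Designs.GoethalsSeidelArray
import Literature.Combinatorics.Designs.LegendrePairs.TwoCirculantCore

/-!
# Hadamard 668 census — the HIT protocol in the kernel: both live families plug into order 668

Framing: lottery ticket; floor = certified bounds/negative ranges.

Cell pub-namedobj (venture DiscreteObjects), target (H).  The two structured families still open at order 668 are
(F2/F3/F6) four circulant `±1` blocks over `ZMod 167` in the Goethals–Seidel array (Williamson and propus are sub-cases) and
(F5) Legendre pairs of length `333` in the two-circulant-core array.  With the formalised plug-ins
(`Literature.Combinatorics.Designs.GoethalsSeidel.goethalsSeidel_isHadamard`, Goethals–Seidel 1970, and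
`Literature.Combinatorics.Designs.LegendrePairs.exists_hadamard_of_legendrePair`, Fletcher–Gysin–Seberry 2001) a HIT in
either family is certified as a Hadamard matrix of order 668 by a structural kernel theorem applied to the first rows —
no `668 × 668` evaluation is needed: `hadamard668_of_gsQuad`, `hadamard668_of_legendrePair333`.  Conversely the census
rows are precisely searches for the hypotheses of these two theorems (`GSQuad a b c d` over `ZMod 167`;
`LegendrePair a b` over `ZMod 333`), and the negative rows landed so far (`no_gs_quad_qr167`, `no_quaternary_pair_qr167`,
`no_gs167_pairs_equal`, `no_gs167_three_equal`, and the tree's `LegendrePairs.*333*` exclusions) remove sub-families of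
those hypotheses.  Ours; no `sorry`, no `native_decide`.
-/

open Matrix

namespace Summit.Ventures.DiscreteObjects.Hadamard

open Literature.Combinatorics.Designs.GoethalsSeidel (gsMatrix IsHadamardMatrix goethalsSeidel_isHadamard)
open Literature.Combinatorics.Designs.LegendrePairs (LegendrePair CoreIdx exists_hadamard_of_legendrePair card_coreIdx)

/-- **HIT protocol, four-circulant families (F2/F3/F6).** Any Goethals–Seidel quadruple over `ZMod 167` — four `±1`
sequences with autocorrelations summing to `0` off zero — yields, through the Goethals–Seidel array, a Hadamard matrix
of order `668 = |Fin 4 × ZMod 167|`. -/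
theorem hadamard668_of_gsQuad (a b c d : ZMod 167 → ℤ) (h : GSQuad a b c d) :
    IsHadamardMatrix (gsMatrix a b c d) ∧ Fintype.card (Fin 4 × ZMod 167) = 668 :=
  ⟨goethalsSeidel_isHadamard a b c d h.1 h.2.1 h.2.2.1 h.2.2.2.1 h.2.2.2.2, by simp [ZMod.card]⟩

/-- **HIT protocol, family F5.** Any Legendre pair of length `333` yields, through the two-circulant-core array, a `±1`
matrix `H` of order `668 = |CoreIdx 333|` with `H Hᵀ = 668·I`. -/
theorem hadamard668_of_legendrePair333 (a b : ZMod 333 → ℤ) (h : LegendrePair a b) :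
    (∃ H : Matrix (CoreIdx 333) (CoreIdx 333) ℤ,
      (∀ x y, H x y = 1 ∨ H x y = -1) ∧ H * Hᵀ = (668 : ℤ) • (1 : Matrix (CoreIdx 333) (CoreIdx 333) ℤ)) ∧
    Fintype.card (CoreIdx 333) = 668 := by
  refine ⟨?_, by rw [card_coreIdx]⟩
  obtain ⟨H, h1, h2⟩ := exists_hadamard_of_legendrePair a b h
  refine ⟨H, h1, ?_⟩
  rw [h2]; norm_num

end Summit.Ventures.DiscreteObjects.Hadamard
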